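import Literature.AlgebraicGeometry.HodgeTheory.HyperplaneSectionLocalSystem
import Literature.AlgebraicGeometry.HodgeTheory.ClassesSupportedOnComplexification
import HarnessLib

/-!
# The rational monodromy representation of a family on `Hᵏ(X_s(ℂ); ℚ)`

Family `hodge`, layer `Literature/AlgebraicGeometry/HodgeTheory` (consumer: crux `LocalTubeSpan` of
route `LinearSystemTorelli` of the Hodge summit, whose algebraic spine lives over `ℚ`).  For the
local systems `Rᵏ π_* ℂ|_U` of a family on its smooth-fibre locus, recorded on the real carriers by
`DirectImageLocalSystem π n` (`HodgeTheory/HyperplaneSectionLocalSystem`), parallel transport is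
induced by homeomorphisms of the fibres and therefore preserves the rational classes
(`DirectImageLocalSystem.transport_isRationalClass`): "the monodromy representation
`ρ : π₁(U, 0) → Aut Hᵏ(X₀, ℤ)`" (C. Voisin, *Hodge Theory and Complex Algebraic Geometry II* (2003),
§3.1.1–3.1.2 and §3.2.2) is defined over the integers, in particular over `ℚ`.  Since the rational
classes of `Hᵏ(X_s(ℂ); ℂ)` are exactly the image of the injective lattice map
`ofRatClass : Hᵏ(X_s(ℂ); ℚ) → Hᵏ(X_s(ℂ); ℂ)` (`isRationalClass_iff_mem_range_ofRatClass`,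
`ofRatClass_injective`, file `HodgeTheory/RealStructureSingular`), the monodromy of every loop
restricts to a `ℚ`-linear endomorphism of `Hᵏ(X_s(ℂ); ℚ)`:

* `DirectImageLocalSystem.ratMonodromy D k s : Representation ℚ (π₁(U, s)) (Hᵏ(X_s(ℂ); ℚ))` — the
  **rational monodromy representation**, characterised by
  `ofRatClass (ratMonodromy γ v) = monodromyBetti γ (ofRatClass v)` (`ofRatClass_ratMonodromy`) and
  unique with this property (`ratMonodromy_unique`);
* `ratMonodromy_map` — restrictions of rational global classes are invariant.
(`Hᵏ(X_s(ℂ); ℚ)` is finite-dimensional for `s` in the smooth-fibre locus: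
`finiteDimensional_bettiCohomology s.2 k`, file `HodgeTheory/ClassesSupportedOnComplexification`.)

With `ofRatClassBaseChangeEquiv : ℂ ⊗_ℚ Hᵏ(X_s; ℚ) ≃ Hᵏ(X_s; ℂ)`
(`HodgeTheory/ClassesSupportedOnComplexification`) this exhibits `monodromyBetti` — equivalently the
monodromy representation `monodromyRepObj (D.V k) s` of the local system — as the complexification
of a finite-dimensional `ℚ`-representation (the consumer's "`ℚ`-form").

## References

* [VoisinHodgeII2003] C. Voisin, Hodge Theory and Complex Algebraic Geometry II, CUP 2003,
  §3.1.1–3.1.2 (local systems and monodromy induced by homeomorphisms of the fibres), §3.2.2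
  (`ρ : π₁(U, 0) → Aut Hᵏ(X₀, ℤ)`).
* [HatcherAT2002] A. Hatcher, Algebraic Topology, CUP 2002, §3.1 p. 198 (change of coefficients).
-/

noncomputable section

open CategoryTheory AlgebraicGeometry
open Literature.AlgebraicTopology.SingularHomology

namespace Literature.AlgebraicGeometry.HodgeTheory

section HodgeTheory

/-! ### Rational restriction of an endomorphism preserving the rational lattice -/

/-- **An endomorphism of `Hᵏ(Y; ℂ)` carrying the rational lattice into itself is induced by a
`ℚ`-linear endomorphism of `Hᵏ(Y; ℚ)`**: if `E (a ⊗ 1)` is rational for every `a ∈ Hᵏ(Y; ℚ)` then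
there is `T : Hᵏ(Y; ℚ) →ₗ[ℚ] Hᵏ(Y; ℚ)` with `(T a) ⊗ 1 = E (a ⊗ 1)` (pointwise preimages; additivity and
homogeneity by injectivity of `ofRatClass` and `ofRatClass_smul`). [cite: HatcherAT2002, §3.1 p. 198] -/
theorem exists_ratEnd_of_mapsTo {Y : Type} [TopologicalSpace Y] (k : ℕ)
    (E : singularCohomology ℂ ℂ Y k →ₗ[ℂ] singularCohomology ℂ ℂ Y k)
    (hE : ∀ a : singularCohomology ℚ ℚ Y k, ∃ b : singularCohomology ℚ ℚ Y k,
      ofRatClass Y k b = E (ofRatClass Y k a)) :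
    ∃ T : singularCohomology ℚ ℚ Y k →ₗ[ℚ] singularCohomology ℚ ℚ Y k,
      ∀ a, ofRatClass Y k (T a) = E (ofRatClass Y k a) := by
  choose t ht using hE
  have hinj : Function.Injective (ofRatClass Y k) := ofRatClass_injective k
  let T : singularCohomology ℚ ℚ Y k →ₗ[ℚ] singularCohomology ℚ ℚ Y k :=
    { toFun := t,
      map_add' := fun a b ↦ hinj (by rw [ht, map_add, map_add, map_add, ht, ht]),
      map_smul' := fun q a ↦ hinj (by
        rw [ht, Motives.ofRatClass_smul, map_smul, RingHom.id_apply, Motives.ofRatClass_smul, ht]) }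
  exact ⟨T, fun a ↦ ht a⟩

variable {𝒳 S : Motives.SchemeOver ℂ} {π : 𝒳 ⟶ S} {n : ℕ}

namespace DirectImageLocalSystem

variable (D : DirectImageLocalSystem π n) (k : ℕ) (s : smoothFiberLocus π n)

/-- The monodromy of a loop preserves the rational lattice: `monodromyBetti γ (a ⊗ 1) = b ⊗ 1` for
some rational `b`. [cite: VoisinHodgeII2003, §3.1.2] -/
theorem exists_ofRatClass_eq_monodromyBetti (γ : FundamentalGroup (smoothFiberLocus π n) s)
    (a : Motives.bettiCohomology (Motives.fiberOver π s.1) k) :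
    ∃ b : Motives.bettiCohomology (Motives.fiberOver π s.1) k,
      ofRatClass _ k b = D.monodromyBetti k s γ (ofRatClass _ k a) := by
  have hrat : IsRationalClass (D.monodromyBetti k s γ (ofRatClass _ k a)) := by
    rw [D.monodromyBetti_apply]
    exact D.isRationalClass_transportBetti k _ (isRationalClass_ofRatClass a)
  obtain ⟨b, hb⟩ := (isRationalClass_iff_mem_range_ofRatClass _).1 hrat
  exact ⟨b, hb⟩

/-- For every loop `γ` there is a `ℚ`-linear endomorphism `T` of `Hᵏ(X_s(ℂ); ℚ)` with
`(T a) ⊗ 1 = monodromyBetti γ (a ⊗ 1)`. [cite: VoisinHodgeII2003, §3.1.2 and §3.2.2] -/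
theorem exists_ratEnd_monodromyBetti (γ : FundamentalGroup (smoothFiberLocus π n) s) :
    ∃ T : Motives.bettiCohomology (Motives.fiberOver π s.1) k →ₗ[ℚ]
        Motives.bettiCohomology (Motives.fiberOver π s.1) k,
      ∀ a, ofRatClass _ k (T a) = D.monodromyBetti k s γ (ofRatClass _ k a) :=
  exists_ratEnd_of_mapsTo k (D.monodromyBetti k s γ) (D.exists_ofRatClass_eq_monodromyBetti k s γ)

/-- **The rational monodromy representation** `π₁(U, s) →* End_ℚ Hᵏ(X_s(ℂ); ℚ)` of the family on
the rational cohomology of the fibre: the restriction of `monodromyBetti` to the rational lattice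
("`ρ : π₁(U, 0) → Aut Hᵏ(X₀, ℤ)`", here with `ℚ`-coefficients). [cite: VoisinHodgeII2003, §3.2.2 and Def. 3.13] -/
def ratMonodromy : Representation ℚ (FundamentalGroup (smoothFiberLocus π n) s)
    (Motives.bettiCohomology (Motives.fiberOver π s.1) k) where
  toFun γ := Classical.choose (D.exists_ratEnd_monodromyBetti k s γ)
  map_one' := by
    refine LinearMap.ext fun a ↦ ofRatClass_injective k ?_
    rw [Classical.choose_spec (D.exists_ratEnd_monodromyBetti k s 1), map_one]
    rfl
  map_mul' γ δ := by
    refine LinearMap.ext fun a ↦ ofRatClass_injective k ?_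
    rw [Classical.choose_spec (D.exists_ratEnd_monodromyBetti k s (γ * δ)), map_mul,
      Module.End.mul_apply, Module.End.mul_apply,
      Classical.choose_spec (D.exists_ratEnd_monodromyBetti k s γ),
      Classical.choose_spec (D.exists_ratEnd_monodromyBetti k s δ)]

/-- **Characterisation**: `(ratMonodromy γ a) ⊗ 1 = monodromyBetti γ (a ⊗ 1)`.
[cite: VoisinHodgeII2003, §3.2.2] -/
theorem ofRatClass_ratMonodromy (γ : FundamentalGroup (smoothFiberLocus π n) s)
    (a : Motives.bettiCohomology (Motives.fiberOver π s.1) k) :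
    ofRatClass _ k (ratMonodromy D k s γ a) = D.monodromyBetti k s γ (ofRatClass _ k a) :=
  Classical.choose_spec (D.exists_ratEnd_monodromyBetti k s γ) a

/-- **Uniqueness**: the rational monodromy is the only representation on `Hᵏ(X_s(ℂ); ℚ)` compatible
with `monodromyBetti` under `ofRatClass` (which is injective). [cite: VoisinHodgeII2003, §3.2.2] -/
theorem ratMonodromy_unique
    (ρ : Representation ℚ (FundamentalGroup (smoothFiberLocus π n) s)
      (Motives.bettiCohomology (Motives.fiberOver π s.1) k))
    (hρ : ∀ (γ : FundamentalGroup (smoothFiberLocus π n) s)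
      (a : Motives.bettiCohomology (Motives.fiberOver π s.1) k),
      ofRatClass _ k (ρ γ a) = D.monodromyBetti k s γ (ofRatClass _ k a)) :
    ρ = ratMonodromy D k s :=
  MonoidHom.ext fun γ ↦ LinearMap.ext fun a ↦ ofRatClass_injective k
    ((hρ γ a).trans (D.ofRatClass_ratMonodromy k s γ a).symm)

/-- Restrictions of rational global classes are invariant under the rational monodromy
(`monodromyBetti_map` on the lattice). [cite: VoisinHodgeII2003, §3.1.2] -/
theorem ratMonodromy_map (γ : FundamentalGroup (smoothFiberLocus π n) s)
    (x : Motives.bettiCohomology 𝒳 k) :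
    ratMonodromy D k s γ (Motives.bettiCohomology.map (Motives.fiberι π s.1) k x) =
      Motives.bettiCohomology.map (Motives.fiberι π s.1) k x := by
  apply ofRatClass_injective k
  rw [D.ofRatClass_ratMonodromy, Motives.ofRatClass_map, D.monodromyBetti_map]

end DirectImageLocalSystem

end HodgeTheory

end Literature.AlgebraicGeometry.HodgeTheory

end
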